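import Mathlib
import Literature.Analysis.FluidPDE.ClassicalSolution
import Literature.Analysis.FluidPDE.AxisymmetricEuler
import Literature.Analysis.FluidPDE.VectorCalculus
import HarnessLib

/-!
# Crux `EulerZoomLiouville.PowerGaugeEulerLiouville` (stmt-NavierStokesRegularity-19832), width sub-line `casimir_haul` (ns-idea-11, REV3):
# THE HAULABLE STRATUM CONTAINS THE THREE OLDER SWIRL-FREE STRATA (containment lemmas for the LEAD's wiring contract)

Seat ns-sfl-p1 g10 (`--supports stmt-NavierStokesRegularity-19832 --as helper`).  LEAD 19832 ns-typeII-p2 g16, 08:03:28Z: when the casimir member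
`(h : InClass ρ u p H c) (hs : IsSlabBoundedSwirlFree u p) : uncurry u =ᵐ 0` lands, the binder `¬ IsSlabBoundedSwirlFree u p` REPLACES the three older
swirl-free binders of `stub_nonSelfSimilarRest` (`¬IsSwirlFreeDrifting`, `¬IsSwirlFreeSlowDrifting`, `¬IsMirrorOutgoing`) «ONLY if the containments are
landed theorems».  This file lands them, with every predicate of `Cruxes/PowerGaugeEulerLiouville/Lines/birth.lean` (v113, 95084b6b56e282cd) and of
`Lines/casimir_haul.lean` (REV3, 31279a74fac8e2c7) δ-UNFOLDED (the skeletons' `IsSwirlFreeDrifting`, `IsSwirlFreeDriftingWith`, `IsSwirlFreeSlowDrifting`,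
`IsMirrorOutgoing`, `IsAxisymSlowDrifting`, `IsSlabBoundedSwirlFree` are `@[reducible] def`s, so each lemma below fills the corresponding implication
by `exact`):

* `slabBound_of_driftEnvelope` — a drift envelope `‖u(τ,x)‖ ≤ M(−τ)^{−κ}` (`τ < 0`; ANY real `M, κ`) bounds the velocity on every compact past slab
  `[T₁,T₀]`, `T₀ < 0`, by `|M|((−T₀)^{−κ} + (−T₁)^{−κ})` (monotonicity of `r ↦ r^{−κ}` on `(0,∞)` in either direction);
* `isSlabBoundedSwirlFree_of_isSwirlFreeDrifting` (`IsSwirlFreeDrifting u p →`), `isSlabBoundedSwirlFree_of_isSwirlFreeDriftingWith`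
  (`IsSwirlFreeDriftingWith u p M κ →`; the Cruxes file's in-file lemma, now importable), `isSlabBoundedSwirlFree_of_isSwirlFreeSlowDrifting`
  (`IsSwirlFreeSlowDrifting ρ u p →`), `isSlabBoundedSwirlFree_of_isMirrorOutgoing` (`IsMirrorOutgoing ρ u p →`: its clause (M4) IS the slab bound),
  `isSlabBoundedSwirlFree_of_isAxisymSlowDrifting` (the swirl-free members of `IsAxisymSlowDrifting ρ u p`).

HONEST FRAMING: bookkeeping between strata of a hypothetical Euler zoom-limit class; nothing here bears on the crux E (19832 OPEN) or on NS
regularity; not E. [folklore]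
-/

noncomputable section

-- flat `Theorems/<Route><Decl>…` files of one crux share the namespace of the crux (tree convention)
set_option linter.dupNamespace false

open MeasureTheory Set Filter Topology Metric Function
open scoped NNReal ENNReal

namespace Summit.NavierStokesRegularity.NavierStokesRegularity.Theorems.PowerGaugeEulerLiouville.CasimirHaul

open Literature.Analysis Literature.Analysis.FluidPDE

/-- **A drift envelope gives slab bounds**: if `‖u(τ,x)‖ ≤ M(−τ)^{−κ}` for all `τ < 0` (any real `M`, `κ`), then on every compact past slab
`[T₁, T₀]`, `T₁ ≤ T₀ < 0`, the velocity is bounded (by `|M|((−T₀)^{−κ} + (−T₁)^{−κ})`). [folklore] -/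
theorem slabBound_of_driftEnvelope {u : ℝ → EuclideanSpace ℝ (Fin 3) → EuclideanSpace ℝ (Fin 3)} {M κ : ℝ}
    (hM : ∀ τ : ℝ, τ < 0 → ∀ x : EuclideanSpace ℝ (Fin 3), ‖u τ x‖ ≤ M * (-τ) ^ (-κ)) :
    ∀ T₁ T₀ : ℝ, T₁ ≤ T₀ → T₀ < 0 → ∃ B : ℝ, ∀ τ ∈ Set.Icc T₁ T₀, ∀ x : EuclideanSpace ℝ (Fin 3), ‖u τ x‖ ≤ B := by
  intro T₁ T₀ h10 hT₀
  refine ⟨|M| * ((-T₀) ^ (-κ) + (-T₁) ^ (-κ)), fun τ hτ x => ?_⟩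
  have hτ0 : τ < 0 := lt_of_le_of_lt hτ.2 hT₀
  have hpos : 0 < -τ := by linarith
  have h0 : 0 ≤ (-T₀) ^ (-κ) := Real.rpow_nonneg (by linarith) _
  have h1 : 0 ≤ (-T₁) ^ (-κ) := Real.rpow_nonneg (by linarith [hτ.1]) _
  -- `(−τ)^{−κ}` is below one of the two endpoint values
  have hr : (-τ) ^ (-κ) ≤ (-T₀) ^ (-κ) + (-T₁) ^ (-κ) := by
    rcases le_or_gt 0 (-κ) with hk | hk
    · have : (-τ) ^ (-κ) ≤ (-T₁) ^ (-κ) := Real.rpow_le_rpow hpos.le (by linarith [hτ.1]) hk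
      linarith
    · have : (-τ) ^ (-κ) ≤ (-T₀) ^ (-κ) :=
        Real.rpow_le_rpow_of_nonpos (by linarith) (by linarith [hτ.2]) hk.le
      linarith
  calc ‖u τ x‖ ≤ M * (-τ) ^ (-κ) := hM τ hτ0 x
    _ ≤ |M| * (-τ) ^ (-κ) := mul_le_mul_of_nonneg_right (le_abs_self M) (Real.rpow_nonneg hpos.le _)
    _ ≤ |M| * ((-T₀) ^ (-κ) + (-T₁) ^ (-κ)) := mul_le_mul_of_nonneg_left hr (abs_nonneg M)

/-- **`IsSwirlFreeDrifting u p → IsSlabBoundedSwirlFree u p`** (both δ-unfolded from `Lines/birth.lean` v113 / `Lines/casimir_haul.lean` REV3):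
the classical axisymmetric swirl-free stratum with sub-parabolic drift `‖u(τ,x)‖ ≤ M(−τ)^{−κ}`, `κ > ½`, lies in the haulable stratum. [folklore] -/
theorem isSlabBoundedSwirlFree_of_isSwirlFreeDrifting {u : ℝ → EuclideanSpace ℝ (Fin 3) → EuclideanSpace ℝ (Fin 3)}
    {p : ℝ → EuclideanSpace ℝ (Fin 3) → ℝ}
    (h : IsClassicalEulerSolutionOn (Set.Iio 0) 0 u p ∧
      (∀ τ : ℝ, τ < 0 → IsAxisymmetric (u τ) ∧ HasNoSwirl (u τ)) ∧
      ∃ M κ : ℝ, 1 / 2 < κ ∧ ∀ τ : ℝ, τ < 0 → ∀ x : EuclideanSpace ℝ (Fin 3), ‖u τ x‖ ≤ M * (-τ) ^ (-κ)) :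
    IsClassicalEulerSolutionOn (Set.Iio 0) 0 u p ∧
      (∀ τ : ℝ, τ < 0 → IsAxisymmetric (u τ) ∧ HasNoSwirl (u τ)) ∧
      (∀ T₁ T₀ : ℝ, T₁ ≤ T₀ → T₀ < 0 → ∃ B : ℝ, ∀ τ ∈ Set.Icc T₁ T₀, ∀ x : EuclideanSpace ℝ (Fin 3), ‖u τ x‖ ≤ B) := by
  obtain ⟨hcl, hsym, M, κ, -, hM⟩ := h
  exact ⟨hcl, hsym, slabBound_of_driftEnvelope hM⟩

/-- **`IsSwirlFreeDriftingWith u p M κ → IsSlabBoundedSwirlFree u p`** (δ-unfolded; the Cruxes file's in-file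
`isSlabBoundedSwirlFree_of_isSwirlFreeDriftingWith`, made importable). [folklore] -/
theorem isSlabBoundedSwirlFree_of_isSwirlFreeDriftingWith {u : ℝ → EuclideanSpace ℝ (Fin 3) → EuclideanSpace ℝ (Fin 3)}
    {p : ℝ → EuclideanSpace ℝ (Fin 3) → ℝ} {M κ : ℝ}
    (h : IsClassicalEulerSolutionOn (Set.Iio 0) 0 u p ∧
      (∀ τ : ℝ, τ < 0 → IsAxisymmetric (u τ) ∧ HasNoSwirl (u τ)) ∧
      0 ≤ M ∧ κ < 1 ∧ ∀ τ : ℝ, τ < 0 → ∀ x : EuclideanSpace ℝ (Fin 3), ‖u τ x‖ ≤ M * (-τ) ^ (-κ)) :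
    IsClassicalEulerSolutionOn (Set.Iio 0) 0 u p ∧
      (∀ τ : ℝ, τ < 0 → IsAxisymmetric (u τ) ∧ HasNoSwirl (u τ)) ∧
      (∀ T₁ T₀ : ℝ, T₁ ≤ T₀ → T₀ < 0 → ∃ B : ℝ, ∀ τ ∈ Set.Icc T₁ T₀, ∀ x : EuclideanSpace ℝ (Fin 3), ‖u τ x‖ ≤ B) := by
  obtain ⟨hcl, hsym, -, -, hM⟩ := h
  exact ⟨hcl, hsym, slabBound_of_driftEnvelope hM⟩

/-- **`IsSwirlFreeSlowDrifting ρ u p → IsSlabBoundedSwirlFree u p`** (δ-unfolded: `∃ M κ, (1−ρ)/(2−ρ) < κ ∧ IsSwirlFreeDriftingWith u p M κ`). [folklore] -/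
theorem isSlabBoundedSwirlFree_of_isSwirlFreeSlowDrifting {ρ : ℝ} {u : ℝ → EuclideanSpace ℝ (Fin 3) → EuclideanSpace ℝ (Fin 3)}
    {p : ℝ → EuclideanSpace ℝ (Fin 3) → ℝ}
    (h : ∃ M κ : ℝ, (1 - ρ) / (2 - ρ) < κ ∧
      (IsClassicalEulerSolutionOn (Set.Iio 0) 0 u p ∧
        (∀ τ : ℝ, τ < 0 → IsAxisymmetric (u τ) ∧ HasNoSwirl (u τ)) ∧
        0 ≤ M ∧ κ < 1 ∧ ∀ τ : ℝ, τ < 0 → ∀ x : EuclideanSpace ℝ (Fin 3), ‖u τ x‖ ≤ M * (-τ) ^ (-κ))) :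
    IsClassicalEulerSolutionOn (Set.Iio 0) 0 u p ∧
      (∀ τ : ℝ, τ < 0 → IsAxisymmetric (u τ) ∧ HasNoSwirl (u τ)) ∧
      (∀ T₁ T₀ : ℝ, T₁ ≤ T₀ → T₀ < 0 → ∃ B : ℝ, ∀ τ ∈ Set.Icc T₁ T₀, ∀ x : EuclideanSpace ℝ (Fin 3), ‖u τ x‖ ≤ B) := by
  obtain ⟨M, κ, -, hW⟩ := h
  exact isSlabBoundedSwirlFree_of_isSwirlFreeDriftingWith hW

/-- **`IsMirrorOutgoing ρ u p → IsSlabBoundedSwirlFree u p`** (δ-unfolded from `Lines/birth.lean` v113): the mirror-outgoing stratum carries the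
slab bound as its last clause (M4). [folklore] -/
theorem isSlabBoundedSwirlFree_of_isMirrorOutgoing {ρ : ℝ} {u : ℝ → EuclideanSpace ℝ (Fin 3) → EuclideanSpace ℝ (Fin 3)}
    {p : ℝ → EuclideanSpace ℝ (Fin 3) → ℝ}
    (h : ∃ R₀ β : ℝ, β < 1 / (2 - ρ) ∧
      (IsClassicalEulerSolutionOn (Set.Iio 0) 0 u p ∧
        (∀ τ : ℝ, τ < 0 → IsAxisymmetric (u τ) ∧ HasNoSwirl (u τ)) ∧
        (∀ τ : ℝ, τ < 0 → ∀ x : EuclideanSpace ℝ (Fin 3),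
          u τ (x - (2 * x 2) • (eZ : EuclideanSpace ℝ (Fin 3))) = u τ x - (2 * u τ x 2) • (eZ : EuclideanSpace ℝ (Fin 3))) ∧
        (∀ τ : ℝ, τ < 0 → ∀ x : EuclideanSpace ℝ (Fin 3), 0 ≤ x 2 * swirl (curl (u τ)) x) ∧
        0 ≤ R₀ ∧ 0 ≤ β ∧
        (∀ τ : ℝ, τ < 0 → ∀ x : EuclideanSpace ℝ (Fin 3), R₀ * (1 + -τ) ^ β < cylRadius x → curl (u τ) x = 0) ∧
        (∀ τ : ℝ, τ < 0 →
          Integrable (fun x : EuclideanSpace ℝ (Fin 3) => (1 + ‖x‖) * ‖u τ x‖ ^ 2) ∧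
            Integrable (fun x : EuclideanSpace ℝ (Fin 3) => (1 + ‖x‖) * (‖curl (u τ) x‖ / cylRadius x))) ∧
        (∀ T T' : ℝ, T ≤ T' → T' < 0 → ∃ B : ℝ, ∀ τ ∈ Set.Icc T T', ∀ x : EuclideanSpace ℝ (Fin 3), ‖u τ x‖ ≤ B))) :
    IsClassicalEulerSolutionOn (Set.Iio 0) 0 u p ∧
      (∀ τ : ℝ, τ < 0 → IsAxisymmetric (u τ) ∧ HasNoSwirl (u τ)) ∧
      (∀ T₁ T₀ : ℝ, T₁ ≤ T₀ → T₀ < 0 → ∃ B : ℝ, ∀ τ ∈ Set.Icc T₁ T₀, ∀ x : EuclideanSpace ℝ (Fin 3), ‖u τ x‖ ≤ B) := by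
  obtain ⟨R₀, β, -, hcl, hsym, -, -, -, -, -, -, hslab⟩ := h
  exact ⟨hcl, hsym, hslab⟩

/-- **The swirl-free members of `IsAxisymSlowDrifting ρ u p` lie in the haulable stratum** (δ-unfolded from `Lines/birth.lean` v113: classical,
axisymmetric velocity and pressure, slow sub-linear drift `‖u(τ,x)‖ ≤ M(−τ)^{−κ}`, `κ ∈ ((1−ρ)/(2−ρ), 1)`; plus the extra hypothesis `HasNoSwirl`). [folklore] -/
theorem isSlabBoundedSwirlFree_of_isAxisymSlowDrifting {ρ : ℝ} {u : ℝ → EuclideanSpace ℝ (Fin 3) → EuclideanSpace ℝ (Fin 3)}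
    {p : ℝ → EuclideanSpace ℝ (Fin 3) → ℝ}
    (h : IsClassicalEulerSolutionOn (Set.Iio 0) 0 u p ∧
      (∀ τ : ℝ, τ < 0 → IsAxisymmetric (u τ) ∧ IsAxisymmetricScalar (p τ)) ∧
      ∃ M κ : ℝ, 0 ≤ M ∧ (1 - ρ) / (2 - ρ) < κ ∧ κ < 1 ∧ ∀ τ : ℝ, τ < 0 → ∀ x : EuclideanSpace ℝ (Fin 3), ‖u τ x‖ ≤ M * (-τ) ^ (-κ))
    (hsw : ∀ τ : ℝ, τ < 0 → HasNoSwirl (u τ)) :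
    IsClassicalEulerSolutionOn (Set.Iio 0) 0 u p ∧
      (∀ τ : ℝ, τ < 0 → IsAxisymmetric (u τ) ∧ HasNoSwirl (u τ)) ∧
      (∀ T₁ T₀ : ℝ, T₁ ≤ T₀ → T₀ < 0 → ∃ B : ℝ, ∀ τ ∈ Set.Icc T₁ T₀, ∀ x : EuclideanSpace ℝ (Fin 3), ‖u τ x‖ ≤ B) := by
  obtain ⟨hcl, hsym, M, κ, -, -, -, hM⟩ := h
  exact ⟨hcl, fun τ hτ => ⟨(hsym τ hτ).1, hsw τ hτ⟩, slabBound_of_driftEnvelope hM⟩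

end Summit.NavierStokesRegularity.NavierStokesRegularity.Theorems.PowerGaugeEulerLiouville.CasimirHaul

end
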